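import Literature.NumberTheory.LFunctions.RayClassConductorUniqueness
import Literature.NumberTheory.NumberFields.ClassGroupPrimesAvoiding
import Mathlib.Algebra.Module.ZMod
import Mathlib.LinearAlgebra.Dimension.Finite
import HarnessLib

/-!
# Counting cubic ray class characters with prescribed ramification

`Proofs` file (theorems only), topic `Literature/NumberTheory/LFunctions`, next to
`RayClassCharacter.lean` (`IsRayClassCharacter`, `idealPow`). The "classical inequality bounding the
`3`-rank of the ring class group modulo `q` of `ℚ(√D)` by `ω(q) + r₃(D) + O(1)`, already used by
Davenport and Heilbronn" (Belabas–Bhargava–Pomerance 2010, proof of Lemma 3.3; Davenport–Heilbronn 1971,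
§6; Hasse 1930), in the language of the tree: for a number field `K`, a finite set `T` of primes
containing the primes above `3`, a multiplicatively closed set `Z ⊆ 𝓞_K` of "killed" integers and a
finite set `S ⊆ 𝓞_K` such that `Z ∪ S` generates the units modulo `𝔪₀ = (∏_{v ∈ T, v ∤ 3} 𝔭_v) · 9`, the
prime-value functions `ψ` of the **cubic** Dirichlet characters modulo any `𝔪` supported on `T`
(`IsRayClassCharacter 𝔪 ψ`, `ψ(𝔭)³ = 1` off `T`, `ψ = 0` on `T`) that kill `Z` (`ψ((z)) = 1`) number at
most `3^{#S} · #Cl(K)[3]` (`ncard_cubicRayClassFunctions_le`).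

Proof (character-free form of the `3`-rank inequality): `ψ((b))` only depends on `b` modulo `𝔪₀` and
cubes (`1 + 𝔪₀` consists of cubes modulo every `𝔪` supported on `T`: Newton's iteration for `c³ = u`
away from `3`, the binomial step `(c + 3ᴺy)³ ≡ c³ + 3ᴺ⁺¹c²y` at `3`, glued by the Chinese remainder
theorem; the square trick `ψ((b)) = ψ((b⁴))` disposes of the signs at the real places), hence is a
monomial in the `ψ((s))`, `s ∈ S`; and `ψ((𝔞))` for an ideal `𝔞` prime to `T` is a monomial in the
`ψ((𝔟ᵢ))` for integral representatives `𝔟ᵢ` prime to `T` of a basis of `Cl(K)/Cl(K)³` (of size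
`3^r = #Cl(K)[3]`) times principal values. So `ψ ↦ (ψ((s)))_s, (ψ((𝔟ᵢ)))ᵢ` is injective into a set
of size `3^{#S + r}`.

## References

* K. Belabas, M. Bhargava, C. Pomerance, *Error estimates for the Davenport–Heilbronn theorems*, Duke
  Math. J. 153 (2010), proof of Lemma 3.3 [BelabasBhargavaPomerance2010].
* H. Davenport, H. Heilbronn, *On the density of discriminants of cubic fields. II*, Proc. Roy. Soc.
  London A 322 (1971) 405–420, §6 [DavenportHeilbronn1971].
* J. Neukirch, *Algebraic Number Theory*, Ch. VI §1, Ch. VII §6 (6.8) [NeukirchANT1999].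
-/

noncomputable section

open IsDedekindDomain IsDedekindDomain.HeightOneSpectrum NumberField Finset
open scoped nonZeroDivisors

namespace Literature.NumberTheory.LFunctions

variable {K : Type*} [Field K] [NumberField K]

/-! ### Algebra of `idealPow` -/

/-- `(ψ₁ψ₂)(𝔞) = ψ₁(𝔞) ψ₂(𝔞)`. [folklore] -/
theorem idealPow_mul_fun (ψ₁ ψ₂ : HeightOneSpectrum (𝓞 K) → ℂ) {I : Ideal (𝓞 K)} (hI : I ≠ ⊥) :
    idealPow K (fun v => ψ₁ v * ψ₂ v) I = idealPow K ψ₁ I * idealPow K ψ₂ I := by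
  unfold idealPow
  rw [← finprod_mul_distrib (mulSupport_idealPow_finite ψ₁ hI) (mulSupport_idealPow_finite ψ₂ hI)]
  exact finprod_congr fun v => mul_pow _ _ _

/-- `(ψⁿ)(𝔞) = ψ(𝔞)ⁿ`. [folklore] -/
theorem idealPow_pow_fun (ψ : HeightOneSpectrum (𝓞 K) → ℂ) (n : ℕ) {I : Ideal (𝓞 K)} (hI : I ≠ ⊥) :
    idealPow K (fun v => ψ v ^ n) I = idealPow K ψ I ^ n := by
  unfold idealPow
  rw [finprod_pow (mulSupport_idealPow_finite ψ hI)]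
  exact finprod_congr fun v => by rw [← pow_mul, ← pow_mul, mul_comm]

/-- A prime of `T` does not divide an ideal prime to `T` (multiplicity `0`). [folklore] -/
theorem count_eq_zero_of_not_le {I : Ideal (𝓞 K)} (hI : I ≠ ⊥) {v : HeightOneSpectrum (𝓞 K)}
    (hv : ¬ I ≤ v.asIdeal) : (Associates.mk v.asIdeal).count (Associates.mk I).factors = 0 := by
  by_contra h
  rw [← Ne, Associates.count_ne_zero_iff_dvd hI v.irreducible, Ideal.dvd_iff_le] at h
  exact hv h

/-- `ψ(𝔞) = 1` if `ψ(𝔭) = 1` at every prime `𝔭 ∣ 𝔞`. [folklore] -/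
theorem idealPow_eq_one_of_forall (ψ : HeightOneSpectrum (𝓞 K) → ℂ) {I : Ideal (𝓞 K)} (hI : I ≠ ⊥)
    (h : ∀ v : HeightOneSpectrum (𝓞 K), I ≤ v.asIdeal → ψ v = 1) : idealPow K ψ I = 1 := by
  unfold idealPow
  refine finprod_eq_one_of_forall_eq_one fun v => ?_
  by_cases hv : I ≤ v.asIdeal
  · rw [h v hv, one_pow]
  · rw [count_eq_zero_of_not_le hI hv, pow_zero]

/-- **Cubic characters take cube-root-of-unity values on ideals prime to `T`**: if `ψ(𝔭)³ = 1` for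
`𝔭 ∉ T` and no prime of `T` divides `𝔞 ≠ 0`, then `ψ(𝔞)³ = 1`. [folklore] -/
theorem idealPow_pow_three_eq_one {T : Finset (HeightOneSpectrum (𝓞 K))} {ψ : HeightOneSpectrum (𝓞 K) → ℂ}
    (hψ : ∀ v, v ∉ T → ψ v ^ 3 = 1) {I : Ideal (𝓞 K)} (hI : I ≠ ⊥)
    (hIT : ∀ v ∈ T, ¬ I ≤ v.asIdeal) : idealPow K ψ I ^ 3 = 1 := by
  rw [← idealPow_pow_fun ψ 3 hI]
  refine idealPow_eq_one_of_forall _ hI fun v hv => hψ v fun hvT => hIT v hvT hv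

/-- `ψ(∏ᵢ 𝔞ᵢ) = ∏ᵢ ψ(𝔞ᵢ)` for nonzero ideals. [folklore] -/
theorem idealPow_prod (ψ : HeightOneSpectrum (𝓞 K) → ℂ) {ι : Type*} (s : Finset ι) (f : ι → Ideal (𝓞 K))
    (hf : ∀ i ∈ s, f i ≠ ⊥) : idealPow K ψ (∏ i ∈ s, f i) = ∏ i ∈ s, idealPow K ψ (f i) := by
  classical
  induction s using Finset.induction_on with
  | empty => rw [prod_empty, prod_empty, Ideal.one_eq_top, idealPow_top]
  | insert a s ha ih =>
    rw [prod_insert ha, prod_insert ha, idealPow_mul ψ (hf a (mem_insert_self a s))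
      (prod_ne_zero_iff.mpr fun i hi => hf i (mem_insert_of_mem hi)), ih fun i hi => hf i (mem_insert_of_mem hi)]

/-- `ψ((xⁿ)) = ψ((x))ⁿ` for a nonzero integer. [folklore] -/
theorem idealPow_span_pow (ψ : HeightOneSpectrum (𝓞 K) → ℂ) {x : 𝓞 K} (hx : x ≠ 0) (n : ℕ) :
    idealPow K ψ (Ideal.span {x ^ n}) = idealPow K ψ (Ideal.span {x}) ^ n := by
  rw [← Ideal.span_singleton_pow, idealPow_pow ψ _ n]
  rw [Ne, Ideal.span_singleton_eq_bot]
  exact hx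

/-! ### Cubes modulo `𝔪`: Newton's iteration away from `3` -/

omit [NumberField K] in
/-- An inverse modulo an ideal from coprimality: `IsCoprime (a) 𝔞 ⇒ ∃ w, a w ≡ 1 mod 𝔞`. [folklore] -/
theorem exists_mul_sub_one_mem_of_isCoprime {a : 𝓞 K} {𝔞 : Ideal (𝓞 K)}
    (h : IsCoprime (Ideal.span {a}) 𝔞) : ∃ w : 𝓞 K, a * w - 1 ∈ 𝔞 := by
  obtain ⟨i, hi, j, hj, hij⟩ := Ideal.isCoprime_iff_exists.mp h
  obtain ⟨w, rfl⟩ := Ideal.mem_span_singleton'.mp hi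
  refine ⟨w, ?_⟩
  have : a * w - 1 = -j := by linear_combination hij
  rw [this]
  exact 𝔞.neg_mem hj

omit [NumberField K] in
/-- `c ≡ 1 mod 𝔞 ⇒ (c)` is prime to `𝔞`. [folklore] -/
theorem isCoprime_span_of_sub_one_mem {c : 𝓞 K} {𝔞 : Ideal (𝓞 K)} (h : c - 1 ∈ 𝔞) :
    IsCoprime (Ideal.span {c}) 𝔞 := by
  refine Ideal.isCoprime_iff_exists.mpr ⟨c, Ideal.mem_span_singleton_self c, 1 - c, ?_, by ring⟩
  have : 1 - c = -(c - 1) := by ring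
  rw [this]
  exact neg_mem h

omit [NumberField K] in
/-- **Newton's iteration for `c³ = u` away from `3`.** If `3` is invertible modulo `𝔞` and
`u ≡ 1 mod 𝔞`, then for every `N` there is `c ≡ 1 mod 𝔞` with `u ≡ c³ mod 𝔞^{N+1}` (step
`c ↦ c + w(u − c³)` with `3c²w ≡ 1`: the error `(u − c³)(1 − 3c²w) − 3c t² − t³` is quadratic).
[folklore] -/
theorem exists_sub_pow_three_mem_pow {𝔞 : Ideal (𝓞 K)} (h3 : IsCoprime (Ideal.span {(3 : 𝓞 K)}) 𝔞)
    {u : 𝓞 K} (hu : u - 1 ∈ 𝔞) (N : ℕ) :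
    ∃ c : 𝓞 K, u - c ^ 3 ∈ 𝔞 ^ (N + 1) ∧ c - 1 ∈ 𝔞 := by
  induction N with
  | zero => exact ⟨1, by simpa using hu, by simp⟩
  | succ N ih =>
    obtain ⟨c, hc, hc1⟩ := ih
    have hcop : IsCoprime (Ideal.span {3 * c ^ 2}) (𝔞 ^ (N + 1)) := by
      rw [← Ideal.span_singleton_mul_span_singleton, ← Ideal.span_singleton_pow]
      exact (IsCoprime.mul_left h3 ((isCoprime_span_of_sub_one_mem hc1).pow_left)).pow_right
    obtain ⟨w, hw⟩ := exists_mul_sub_one_mem_of_isCoprime hcop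
    set t := w * (u - c ^ 3) with ht
    have htmem : t ∈ 𝔞 ^ (N + 1) := Ideal.mul_mem_left _ w hc
    have hle : 𝔞 ^ (N + 1) * 𝔞 ^ (N + 1) ≤ 𝔞 ^ (N + 1 + 1) := by
      rw [← pow_add]
      exact Ideal.pow_le_pow_right (by omega)
    refine ⟨c + t, ?_, ?_⟩
    · have key : u - (c + t) ^ 3 = (u - c ^ 3) * (1 - 3 * c ^ 2 * w) - t * t * (3 * c + t) := by
        rw [ht]; ring
      rw [key]
      refine Ideal.sub_mem _ (hle (Ideal.mul_mem_mul hc ?_)) ?_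
      · have : 1 - 3 * c ^ 2 * w = -(3 * c ^ 2 * w - 1) := by ring
        rw [this]
        exact neg_mem hw
      · exact Ideal.mul_mem_right _ _ (hle (Ideal.mul_mem_mul htmem htmem))
    · have : c + t - 1 = (c - 1) + t := by ring
      rw [this]
      exact 𝔞.add_mem hc1 (Ideal.pow_le_self (Nat.succ_ne_zero N) htmem)

/-! ### Cubes modulo powers of `3` -/

omit [NumberField K] in
/-- **Cubes modulo `3ᴺ`.** If `u ≡ 1 mod 9` then for every `N` there is `c ≡ 1 mod 3` with
`u ≡ c³ mod 3^{N+2}` (step `c ↦ c + 3^{N+1}y` for `u − c³ = 3^{N+2}y`: since `c ≡ 1 mod 3`,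
`(c + 3^{N+1}y)³ ≡ c³ + 3^{N+2}c²y ≡ u mod 3^{N+3}`). [folklore] -/
theorem exists_pow_three_dvd_sub_pow_three {u : 𝓞 K} (hu : (9 : 𝓞 K) ∣ u - 1) (N : ℕ) :
    ∃ c : 𝓞 K, (3 : 𝓞 K) ^ (N + 2) ∣ u - c ^ 3 ∧ (3 : 𝓞 K) ∣ c - 1 := by
  induction N with
  | zero => exact ⟨1, by norm_num; simpa using hu, by simp⟩
  | succ N ih =>
    obtain ⟨c, ⟨y, hy⟩, ⟨r, hr⟩⟩ := ih
    refine ⟨c + 3 ^ (N + 1) * y, ⟨-(r * (c + 1) * y + 3 ^ N * c * y ^ 2 + 3 ^ (2 * N) * y ^ 3), ?_⟩,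
      ⟨r + 3 ^ N * y, ?_⟩⟩
    · have h1 : u = c ^ 3 + 3 ^ (N + 2) * y := by linear_combination hy
      have h2 : c = 1 + 3 * r := by linear_combination hr
      rw [h1, h2]
      ring
    · linear_combination hr

/-! ### Cubes modulo an ideal supported on `T` -/

omit [NumberField K] in
/-- Chinese remainder theorem for two coprime ideals, element form. [folklore] -/
theorem exists_sub_mem_and_sub_mem {I J : Ideal (𝓞 K)} (h : IsCoprime I J) (a b : 𝓞 K) :
    ∃ x : 𝓞 K, x - a ∈ I ∧ x - b ∈ J := by
  obtain ⟨i, hi, j, hj, hij⟩ := Ideal.isCoprime_iff_exists.mp h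
  refine ⟨a * j + b * i, ?_, ?_⟩
  · have : a * j + b * i - a = (b - a) * i := by linear_combination a * hij
    rw [this]; exact I.mul_mem_left _ hi
  · have : a * j + b * i - b = (a - b) * j := by linear_combination b * hij
    rw [this]; exact J.mul_mem_left _ hj

open scoped Classical in
/-- `(3)` is prime to a product of primes not containing `3`. [folklore] -/
theorem isCoprime_span_three_prod (T : Finset (HeightOneSpectrum (𝓞 K))) :
    IsCoprime (Ideal.span {(3 : 𝓞 K)})
      (∏ v ∈ T.filter (fun v => (3 : 𝓞 K) ∉ v.asIdeal), v.asIdeal) := by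
  refine IsCoprime.prod_right fun v hv => ?_
  rw [mem_filter] at hv
  rw [Ideal.isCoprime_iff_sup_eq]
  have hlt : v.asIdeal < Ideal.span {(3 : 𝓞 K)} ⊔ v.asIdeal :=
    lt_of_le_of_ne le_sup_right fun h => hv.2 (h ▸ Ideal.mem_sup_left (Ideal.mem_span_singleton_self 3))
  exact v.isMaximal.1.2 _ hlt

open scoped Classical in
/-- **`1 + 𝔪₀` consists of cubes modulo every modulus supported on `T`**, where
`𝔪₀ = (∏_{v ∈ T, v ∤ 3} 𝔭_v) · 9`: if `u ≡ 1 mod 𝔪₀` then for every `N` there is `c` with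
`u ≡ c³ mod (∏_{v ∈ T, v ∤ 3} 𝔭_v)^{N+1} · 3^{N+2}` and `c ≡ 1 mod 𝔭_v` for all `v ∈ T` with `v ∤ 3` or
`v ∣ 3`. (Newton away from `3`, the binomial step at `3`, Chinese remainder theorem.) [folklore] -/
theorem exists_sub_pow_three_mem (T : Finset (HeightOneSpectrum (𝓞 K))) {u : 𝓞 K}
    (hu : u - 1 ∈ (∏ v ∈ T.filter (fun v => (3 : 𝓞 K) ∉ v.asIdeal), v.asIdeal) * Ideal.span {(9 : 𝓞 K)})
    (N : ℕ) :
    ∃ c : 𝓞 K, u - c ^ 3 ∈ (∏ v ∈ T.filter (fun v => (3 : 𝓞 K) ∉ v.asIdeal), v.asIdeal) ^ (N + 1) *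
        Ideal.span {(3 : 𝓞 K)} ^ (N + 2) ∧
      (∀ v ∈ T, c - 1 ∈ v.asIdeal) ∧ c - 1 ∈ Ideal.span {(3 : 𝓞 K)} := by
  set 𝔞₀ := ∏ v ∈ T.filter (fun v => (3 : 𝓞 K) ∉ v.asIdeal), v.asIdeal with h𝔞₀
  have h3 : IsCoprime (Ideal.span {(3 : 𝓞 K)}) 𝔞₀ := isCoprime_span_three_prod T
  -- away from `3`
  obtain ⟨c₁, hc₁, hc₁1⟩ := exists_sub_pow_three_mem_pow h3 (Ideal.mul_le_right hu) N
  -- at `3`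
  have hu9 : (9 : 𝓞 K) ∣ u - 1 := Ideal.mem_span_singleton.mp (Ideal.mul_le_left hu)
  obtain ⟨c₂, hc₂, hc₂1⟩ := exists_pow_three_dvd_sub_pow_three hu9 N
  -- glue
  have hcop : IsCoprime (𝔞₀ ^ (N + 1)) (Ideal.span {(3 : 𝓞 K)} ^ (N + 2)) :=
    (h3.symm.pow_left).pow_right
  obtain ⟨c, hcc₁, hcc₂⟩ := exists_sub_mem_and_sub_mem hcop c₁ c₂
  have hfac : ∀ a b : 𝓞 K, a ^ 3 - b ^ 3 = (a - b) * (a ^ 2 + a * b + b ^ 2) := fun a b => by ring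
  refine ⟨c, ?_, ?_, ?_⟩
  · rw [Ideal.mul_eq_inf_of_isCoprime hcop]
    refine ⟨?_, ?_⟩
    · have : u - c ^ 3 = (u - c₁ ^ 3) - (c - c₁) * (c ^ 2 + c * c₁ + c₁ ^ 2) := by ring
      rw [this]
      exact Ideal.sub_mem _ hc₁ (Ideal.mul_mem_right _ _ hcc₁)
    · have : u - c ^ 3 = (u - c₂ ^ 3) - (c - c₂) * (c ^ 2 + c * c₂ + c₂ ^ 2) := by ring
      rw [this]
      refine Ideal.sub_mem _ ?_ (Ideal.mul_mem_right _ _ hcc₂)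
      rw [Ideal.span_singleton_pow]
      exact Ideal.mem_span_singleton.mpr hc₂
  · intro v hv
    by_cases hv3 : (3 : 𝓞 K) ∈ v.asIdeal
    · have h3le : Ideal.span {(3 : 𝓞 K)} ≤ v.asIdeal := (Ideal.span_singleton_le_iff_mem _).mpr hv3
      have h1 : c - c₂ ∈ v.asIdeal :=
        h3le (Ideal.pow_le_self (by omega) hcc₂)
      have h2 : c₂ - 1 ∈ v.asIdeal := h3le (Ideal.mem_span_singleton.mpr hc₂1)
      have : c - 1 = (c - c₂) + (c₂ - 1) := by ring
      rw [this]; exact v.asIdeal.add_mem h1 h2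
    · have hle : 𝔞₀ ≤ v.asIdeal := by
        rw [h𝔞₀]
        exact (Ideal.prod_le_inf).trans (Finset.inf_le (mem_filter.mpr ⟨hv, hv3⟩))
      have h1 : c - c₁ ∈ v.asIdeal := hle (Ideal.pow_le_self (by omega) hcc₁)
      have h2 : c₁ - 1 ∈ v.asIdeal := hle hc₁1
      have : c - 1 = (c - c₁) + (c₁ - 1) := by ring
      rw [this]; exact v.asIdeal.add_mem h1 h2
  · have h1 : c - c₂ ∈ Ideal.span {(3 : 𝓞 K)} := Ideal.pow_le_self (by omega) hcc₂
    have : c - 1 = (c - c₂) + (c₂ - 1) := by ring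
    rw [this]
    exact Ideal.add_mem _ h1 (Ideal.mem_span_singleton.mpr hc₂1)

/-! ### The values `ψ((b))` are monomials in the `ψ((s))`, `s ∈ S` -/

open scoped Classical in
/-- The primes dividing `(∏_{v ∈ T, v ∤ 3} 𝔭_v)^{N+1} · 3^{N+2}` lie in `T` (when `T` contains the primes
above `3`). [folklore] -/
theorem mem_of_modulus_le (T : Finset (HeightOneSpectrum (𝓞 K)))
    (hT3 : ∀ v : HeightOneSpectrum (𝓞 K), (3 : 𝓞 K) ∈ v.asIdeal → v ∈ T) (N : ℕ)
    {v : HeightOneSpectrum (𝓞 K)}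
    (hv : (∏ w ∈ T.filter (fun w => (3 : 𝓞 K) ∉ w.asIdeal), w.asIdeal) ^ (N + 1) *
      Ideal.span {(3 : 𝓞 K)} ^ (N + 2) ≤ v.asIdeal) : v ∈ T := by
  rcases (Ideal.IsPrime.mul_le v.isPrime).mp hv with h | h
  · rw [Ideal.IsPrime.pow_le_iff (hP := v.isPrime) (Nat.succ_ne_zero N),
      Ideal.IsPrime.prod_le v.isPrime] at h
    obtain ⟨w, hw, hwv⟩ := h
    have : w = v := HeightOneSpectrum.ext (w.isMaximal.eq_of_le v.isPrime.ne_top hwv)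
    exact this ▸ (mem_filter.mp hw).1
  · rw [Ideal.IsPrime.pow_le_iff (hP := v.isPrime) (Nat.succ_ne_zero _),
      Ideal.span_singleton_le_iff_mem] at h
    exact hT3 v h

omit [NumberField K] in
/-- An element lying in no prime of `T` generates an ideal prime to every nonzero modulus supported
on `T`. [folklore] -/
theorem isCoprime_span_of_forall_not_mem {T : Finset (HeightOneSpectrum (𝓞 K))} {𝔪 : Ideal (𝓞 K)}
    (h𝔪 : 𝔪 ≠ ⊥) (hsupp : ∀ v : HeightOneSpectrum (𝓞 K), 𝔪 ≤ v.asIdeal → v ∈ T) {y : 𝓞 K}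
    (hy : ∀ v ∈ T, y ∉ v.asIdeal) : IsCoprime (Ideal.span {y}) 𝔪 := by
  rw [isCoprime_iff_forall_not_le h𝔪]
  intro v hv hle
  exact hy v (hsupp v hv) ((Ideal.span_singleton_le_iff_mem _).mp hle)

omit [NumberField K] in
/-- A product of elements outside a prime lies outside it. [folklore] -/
theorem prod_pow_not_mem {S : Finset (𝓞 K)} {v : HeightOneSpectrum (𝓞 K)}
    (hS : ∀ s ∈ S, s ∉ v.asIdeal) (n : 𝓞 K → ℕ) : ∏ s ∈ S, s ^ n s ∉ v.asIdeal := by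
  haveI := v.isPrime
  rw [Ideal.IsPrime.prod_mem_iff]
  rintro ⟨s, hs, hsn⟩
  exact hS s hs (v.isPrime.mem_of_pow_mem _ hsn)

open scoped Classical in
/-- **`ψ((b))` is a monomial in the `ψ((s))`, `s ∈ S`, with exponents independent of `ψ`.**  Let `T`
contain the primes above `3`, let `Z ⊆ 𝓞_K ∖ ⋃ T` and `S ⊆ 𝓞_K ∖ ⋃ T` (finite) be such that every
`x` prime to `T` is `≡ z · ∏_s s^{n_s} mod 𝔪₀ = (∏_{v ∈ T, v ∤ 3} 𝔭_v) · 9` for some `z ∈ Z`, and let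
`b ≠ 0` be prime to `T`.  Then there are exponents `k_s` such that `ψ((b)) = ∏_s ψ((s))^{k_s}` for EVERY
Dirichlet character `ψ` modulo `𝔪_N = (∏_{v ∈ T, v ∤ 3} 𝔭_v)^{N+1} 3^{N+2}` with `ψ(𝔭)³ = 1` off `T` and
`ψ((z)) = 1` on `Z`.  Proof: `b² ≡ z ∏ s^{n_s} · u` with `u ≡ 1 mod 𝔪₀`, `u ≡ c³ mod 𝔪_N`
(`exists_sub_pow_three_mem`), so `b⁴ ≡ (z ∏ s^{n_s} c³)² mod 𝔪_N` with both sides totally positive,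
whence `ψ((b)) = ψ((b))⁴ = ψ((b⁴)) = ψ((z))² ∏ ψ((s))^{2n_s} ψ((c))⁶ = ∏ ψ((s))^{2n_s}` (Davenport–Heilbronn
1971, §6; Belabas–Bhargava–Pomerance 2010, proof of Lemma 3.3: the `3`-rank of the ring class group).
[cite: BelabasBhargavaPomerance2010, proof of Lemma 3.3] -/
theorem exists_idealPow_span_eq_prod (T : Finset (HeightOneSpectrum (𝓞 K))) (hT : T.Nonempty)
    (hT3 : ∀ v : HeightOneSpectrum (𝓞 K), (3 : 𝓞 K) ∈ v.asIdeal → v ∈ T)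
    {Z : Set (𝓞 K)} (hZT : ∀ z ∈ Z, ∀ v ∈ T, z ∉ v.asIdeal)
    {S : Finset (𝓞 K)} (hST : ∀ s ∈ S, ∀ v ∈ T, s ∉ v.asIdeal)
    (hgen : ∀ x : 𝓞 K, (∀ v ∈ T, x ∉ v.asIdeal) → ∃ z ∈ Z, ∃ n : 𝓞 K → ℕ,
      x - z * ∏ s ∈ S, s ^ n s ∈
        (∏ v ∈ T.filter (fun v => (3 : 𝓞 K) ∉ v.asIdeal), v.asIdeal) * Ideal.span {(9 : 𝓞 K)})
    (N : ℕ) {b : 𝓞 K} (hbT : ∀ v ∈ T, b ∉ v.asIdeal) :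
    ∃ k : 𝓞 K → ℕ, ∀ ψ : HeightOneSpectrum (𝓞 K) → ℂ,
      IsRayClassCharacter ((∏ v ∈ T.filter (fun v => (3 : 𝓞 K) ∉ v.asIdeal), v.asIdeal) ^ (N + 1) *
        Ideal.span {(3 : 𝓞 K)} ^ (N + 2)) ψ →
      (∀ v, v ∉ T → ψ v ^ 3 = 1) → (∀ z ∈ Z, idealPow K ψ (Ideal.span {z}) = 1) →
      idealPow K ψ (Ideal.span {b}) = ∏ s ∈ S, idealPow K ψ (Ideal.span {s}) ^ k s := by
  obtain ⟨v₀, hv₀⟩ := hT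
  -- nonvanishing from coprimality to the nonempty `T`
  have ne_zero_of : ∀ {x : 𝓞 K}, (∀ v ∈ T, x ∉ v.asIdeal) → x ≠ 0 := fun hx h0 =>
    hx v₀ hv₀ (h0 ▸ v₀.asIdeal.zero_mem)
  set 𝔞₀ := ∏ v ∈ T.filter (fun v => (3 : 𝓞 K) ∉ v.asIdeal), v.asIdeal with h𝔞₀
  set 𝔪 := 𝔞₀ ^ (N + 1) * Ideal.span {(3 : 𝓞 K)} ^ (N + 2) with h𝔪def
  have h𝔞₀0 : 𝔞₀ ≠ ⊥ := by
    rw [h𝔞₀, Ne, ← Submodule.zero_eq_bot, prod_eq_zero_iff]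
    rintro ⟨v, -, hv⟩
    exact v.ne_bot hv
  have h30 : Ideal.span {(3 : 𝓞 K)} ≠ ⊥ := by
    rw [Ne, Ideal.span_singleton_eq_bot]; norm_num
  have h𝔪0 : 𝔪 ≠ ⊥ := by
    rw [h𝔪def, Ne, ← Submodule.zero_eq_bot, mul_eq_zero, not_or]
    exact ⟨pow_ne_zero _ h𝔞₀0, pow_ne_zero _ h30⟩
  have hsupp : ∀ v : HeightOneSpectrum (𝓞 K), 𝔪 ≤ v.asIdeal → v ∈ T := fun v hv =>
    mem_of_modulus_le T hT3 N hv
  have h𝔪le : 𝔪 ≤ 𝔞₀ * Ideal.span {(9 : 𝓞 K)} := by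
    refine Ideal.mul_mono (Ideal.pow_le_self (Nat.succ_ne_zero N)) ?_
    rw [show (9 : 𝓞 K) = 3 ^ 2 by norm_num, ← Ideal.span_singleton_pow]
    exact Ideal.pow_le_pow_right (by omega)
  -- `b² ≡ y = z ∏ s^{n s} mod 𝔪₀`
  have hb2T : ∀ v ∈ T, b ^ 2 ∉ v.asIdeal := fun v hv h => hbT v hv (v.isPrime.mem_of_pow_mem 2 h)
  obtain ⟨z, hz, n, hy⟩ := hgen (b ^ 2) hb2T
  set y := z * ∏ s ∈ S, s ^ n s with hydef
  have hyT : ∀ v ∈ T, y ∉ v.asIdeal := fun v hv h => by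
    rcases v.isPrime.mem_or_mem h with h | h
    · exact hZT z hz v hv h
    · exact prod_pow_not_mem (fun s hs => hST s hs v hv) n h
  -- an inverse `y'` of `y` modulo `𝔪`, and `u = b² y' ≡ 1 mod 𝔪₀`
  obtain ⟨y', hy'⟩ := exists_mul_sub_one_mem_of_isCoprime (isCoprime_span_of_forall_not_mem h𝔪0 hsupp hyT)
  have hu : b ^ 2 * y' - 1 ∈ 𝔞₀ * Ideal.span {(9 : 𝓞 K)} := by
    have : b ^ 2 * y' - 1 = y' * (b ^ 2 - y) + (y * y' - 1) := by ring
    rw [this]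
    exact Ideal.add_mem _ (Ideal.mul_mem_left _ _ hy) (h𝔪le hy')
  -- `u ≡ c³ mod 𝔪`
  obtain ⟨c, hc, hc1, -⟩ := exists_sub_pow_three_mem T hu N
  have hcT : ∀ v ∈ T, c ∉ v.asIdeal := fun v hv h => by
    have : (1 : 𝓞 K) = c - (c - 1) := by ring
    exact v.isPrime.ne_top ((Ideal.eq_top_iff_one _).mpr (this ▸ v.asIdeal.sub_mem h (hc1 v hv)))
  -- `Y = y c³`, `b⁴ ≡ Y² mod 𝔪`
  set Y := y * c ^ 3 with hYdef
  have hYT : ∀ v ∈ T, Y ∉ v.asIdeal := fun v hv h => by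
    rcases v.isPrime.mem_or_mem h with h | h
    · exact hyT v hv h
    · exact hcT v hv (v.isPrime.mem_of_pow_mem 3 h)
  have hb4 : b ^ 4 - Y ^ 2 ∈ 𝔪 := by
    have h1 : b ^ 2 - Y ∈ 𝔪 := by
      have : b ^ 2 - Y = y * (b ^ 2 * y' - c ^ 3) - b ^ 2 * (y * y' - 1) := by rw [hYdef]; ring
      rw [this]
      exact Ideal.sub_mem _ (Ideal.mul_mem_left _ _ hc) (Ideal.mul_mem_left _ _ hy')
    have : b ^ 4 - Y ^ 2 = (b ^ 2 + Y) * (b ^ 2 - Y) := by ring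
    rw [this]
    exact Ideal.mul_mem_left _ _ h1
  have hb0 : b ≠ 0 := ne_zero_of hbT
  have hY0 : Y ≠ 0 := ne_zero_of hYT
  have hz0 : z ≠ 0 := ne_zero_of (hZT z hz)
  have hc0 : c ≠ 0 := ne_zero_of hcT
  have hs0 : ∀ s ∈ S, s ≠ 0 := fun s hs => ne_zero_of (hST s hs)
  refine ⟨fun s => 2 * n s, fun ψ hray hcube hZ => ?_⟩
  -- `ψ((b)) = ψ((b⁴)) = ψ((Y²))`
  have hb3 : idealPow K ψ (Ideal.span {b}) ^ 3 = 1 :=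
    idealPow_pow_three_eq_one hcube (by rw [Ne, Ideal.span_singleton_eq_bot]; exact hb0)
      fun v hv hle => hbT v hv ((Ideal.span_singleton_le_iff_mem _).mp hle)
  have hc3 : idealPow K ψ (Ideal.span {c}) ^ 3 = 1 :=
    idealPow_pow_three_eq_one hcube (by rw [Ne, Ideal.span_singleton_eq_bot]; exact hc0)
      fun v hv hle => hcT v hv ((Ideal.span_singleton_le_iff_mem _).mp hle)
  have step1 : idealPow K ψ (Ideal.span {b}) = idealPow K ψ (Ideal.span {b ^ 4}) := by
    rw [idealPow_span_pow ψ hb0, pow_succ, hb3, one_mul]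
  have step2 : idealPow K ψ (Ideal.span {b ^ 4}) = idealPow K ψ (Ideal.span {Y ^ 2}) := by
    refine hray.idealPow_span_eq (b ^ 4) (Y ^ 2) (pow_ne_zero 4 hb0) (pow_ne_zero 2 hY0)
      (isCoprime_span_of_forall_not_mem h𝔪0 hsupp fun v hv h => hYT v hv (v.isPrime.mem_of_pow_mem 2 h))
      hb4 fun φ => ?_
    have hφb : φ b ≠ 0 := by
      rw [map_ne_zero]; exact_mod_cast hb0
    have hφY : φ Y ≠ 0 := by
      rw [map_ne_zero]; exact_mod_cast hY0
    have : φ ((b ^ 4 : 𝓞 K) : K) * φ ((Y ^ 2 : 𝓞 K) : K) = (φ b ^ 2 * φ Y) ^ 2 := by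
      push_cast
      rw [map_pow, map_pow]
      ring
    rw [this]
    positivity
  have step3 : idealPow K ψ (Ideal.span {Y ^ 2}) = ∏ s ∈ S, idealPow K ψ (Ideal.span {s}) ^ (2 * n s) := by
    rw [idealPow_span_pow ψ hY0, hYdef, ← Ideal.span_singleton_mul_span_singleton,
      idealPow_mul ψ (by rw [Ne, Ideal.span_singleton_eq_bot]; exact ne_zero_of hyT)
        (by rw [Ne, Ideal.span_singleton_eq_bot]; exact pow_ne_zero 3 hc0),
      idealPow_span_pow ψ hc0, hc3, mul_one, hydef, ← Ideal.span_singleton_mul_span_singleton,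
      idealPow_mul ψ (by rw [Ne, Ideal.span_singleton_eq_bot]; exact hz0)
        (by rw [Ne, Ideal.span_singleton_eq_bot]; exact ne_zero_of fun v hv => prod_pow_not_mem (fun s hs => hST s hs v hv) n),
      hZ z hz, one_mul, idealPow_span_prod ψ S _ (fun s hs => pow_ne_zero _ (hs0 s hs)), ← prod_pow]
    refine prod_congr rfl fun s hs => ?_
    rw [idealPow_span_pow ψ (hs0 s hs), ← pow_mul, mul_comm]
  rw [step1, step2, step3]

/-! ### Every modulus supported on `T` contains some `𝔪_N` -/

open scoped Classical in
omit [NumberField K] in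
/-- Antitonicity of `𝔪_N = (∏_{v ∈ T, v ∤ 3} 𝔭_v)^{N+1} 3^{N+2}` in `N`. [folklore] -/
theorem modulus_le_modulus (T : Finset (HeightOneSpectrum (𝓞 K))) {N N' : ℕ} (h : N ≤ N') :
    (∏ v ∈ T.filter (fun v => (3 : 𝓞 K) ∉ v.asIdeal), v.asIdeal) ^ (N' + 1) *
        Ideal.span {(3 : 𝓞 K)} ^ (N' + 2) ≤
      (∏ v ∈ T.filter (fun v => (3 : 𝓞 K) ∉ v.asIdeal), v.asIdeal) ^ (N + 1) *
        Ideal.span {(3 : 𝓞 K)} ^ (N + 2) :=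
  Ideal.mul_mono (Ideal.pow_le_pow_right (by omega)) (Ideal.pow_le_pow_right (by omega))

open scoped Classical in
/-- **Every nonzero modulus `𝔪` supported on `T` contains `𝔪_N` for some `N`** (`T` containing the
primes above `3`): `𝔪 = ∏_{v ∈ T} 𝔭_v^{c_v}` and `𝔪_N ⊆ 𝔭_v^{c_v}` for `N ≥ max c_v`. [folklore] -/
theorem exists_modulus_le {T : Finset (HeightOneSpectrum (𝓞 K))} {𝔪 : Ideal (𝓞 K)} (h𝔪 : 𝔪 ≠ ⊥)
    (hsupp : ∀ v : HeightOneSpectrum (𝓞 K), 𝔪 ≤ v.asIdeal → v ∈ T) :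
    ∃ N : ℕ, (∏ v ∈ T.filter (fun v => (3 : 𝓞 K) ∉ v.asIdeal), v.asIdeal) ^ (N + 1) *
      Ideal.span {(3 : 𝓞 K)} ^ (N + 2) ≤ 𝔪 := by
  set c : HeightOneSpectrum (𝓞 K) → ℕ := fun v =>
    (Associates.mk v.asIdeal).count (Associates.mk 𝔪).factors with hc
  have hfac : ∏ v ∈ T, v.asIdeal ^ c v = 𝔪 := by
    rw [← finprod_eq_prod_of_mulSupport_subset (fun v : HeightOneSpectrum (𝓞 K) => v.asIdeal ^ c v)
      (s := T) ?_]
    · exact Ideal.finprod_heightOneSpectrum_factorization h𝔪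
    · intro v hv
      rw [Function.mem_mulSupport] at hv
      refine hsupp v (Ideal.le_of_dvd ((Associates.count_ne_zero_iff_dvd h𝔪 v.irreducible).mp ?_))
      intro h0
      exact hv (by rw [show c v = 0 from h0, pow_zero])
  refine ⟨T.sup c, ?_⟩
  set N := T.sup c with hN
  have hinf := HeightOneSpectrum.inf_pow_eq_prod T c (fun v => v) fun v _ w _ h => h
  rw [← hfac, ← hinf]
  refine Finset.le_inf fun v hv => ?_
  have hcv : c v ≤ N := Finset.le_sup hv
  by_cases hv3 : (3 : 𝓞 K) ∈ v.asIdeal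
  · refine (Ideal.mul_le_left).trans ((Ideal.pow_right_mono ?_ _).trans (Ideal.pow_le_pow_right (by omega)))
    exact (Ideal.span_singleton_le_iff_mem _).mpr hv3
  · refine (Ideal.mul_le_right).trans ((Ideal.pow_right_mono ?_ _).trans (Ideal.pow_le_pow_right (by omega)))
    exact (Ideal.prod_le_inf).trans (Finset.inf_le (mem_filter.mpr ⟨hv, hv3⟩))

/-! ### The class group modulo cubes -/

/-- **Every ideal class contains an integral ideal prime to `T`** (the tree's
`ClassGroup.mem_closure_mk0_prime_not_mem`, spelled out on representatives). [cite: NeukirchANT1999, Ch. VI §1 (every ideal class contains an ideal prime to a given ideal)] -/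
theorem exists_ideal_mk0_eq (T : Finset (HeightOneSpectrum (𝓞 K))) (c : ClassGroup (𝓞 K)) :
    ∃ (I : Ideal (𝓞 K)) (hI : I ≠ ⊥), (∀ v ∈ T, ¬ I ≤ v.asIdeal) ∧
      ClassGroup.mk0 ⟨I, mem_nonZeroDivisors_iff_ne_zero.mpr hI⟩ = c := by
  refine Subgroup.closure_induction'' (p := fun c _ => ∃ (I : Ideal (𝓞 K)) (hI : I ≠ ⊥),
      (∀ v ∈ T, ¬ I ≤ v.asIdeal) ∧ ClassGroup.mk0 ⟨I, mem_nonZeroDivisors_iff_ne_zero.mpr hI⟩ = c)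
    ?_ ?_ ?_ ?_ (NumberFields.ClassGroup.mem_closure_mk0_prime_not_mem T c)
  · rintro _ ⟨v, hv, rfl⟩
    refine ⟨v.asIdeal, v.ne_bot, fun w hw hle => ?_, rfl⟩
    have : v = w := HeightOneSpectrum.ext (v.isMaximal.eq_of_le w.isPrime.ne_top hle)
    exact hv (this ▸ hw)
  · rintro _ ⟨v, -, rfl⟩
    obtain ⟨a, 𝔟, ha0, hab, h𝔟T⟩ := NumberFields.ClassGroup.exists_mul_eq_span_and_forall_not_mem v T
    have h𝔟0 : 𝔟 ≠ ⊥ := by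
      rintro rfl
      rw [Ideal.mul_bot, eq_comm, Ideal.span_singleton_eq_bot] at hab
      exact ha0 hab
    refine ⟨𝔟, h𝔟0, fun w hw hle => h𝔟T w hw (Ideal.dvd_iff_le.mpr hle), ?_⟩
    exact ClassGroup.mk0_eq_mk0_inv_iff.mpr ⟨a, ha0, by rw [mul_comm]; exact hab⟩
  · refine ⟨⊤, top_ne_bot, fun w _ hle => w.isPrime.ne_top (top_le_iff.mp hle), ?_⟩
    rw [ClassGroup.mk0_eq_one_iff]
    exact ⟨⟨1, by rw [Ideal.submodule_span_eq, Ideal.span_singleton_one]⟩⟩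
  · rintro x y - - ⟨I, hI, hIT, rfl⟩ ⟨J, hJ, hJT, rfl⟩
    refine ⟨I * J, ?_, fun w hw hle => ?_, ?_⟩
    · rw [Ne, ← Submodule.zero_eq_bot, mul_eq_zero, not_or]
      exact ⟨hI, hJ⟩
    · rcases (Ideal.IsPrime.mul_le w.isPrime).mp hle with h | h
      · exact hIT w hw h
      · exact hJT w hw h
    · rw [← map_mul]
      rfl

/-- **A basis of `G/G³`**: a finite abelian group `G` has elements `g₁, …, g_r` with `3^r = #G[3]` such
that every element is `∏ gᵢ^{nᵢ}` times a cube (`G/G³` is an `𝔽₃`-vector space of dimension `r`, and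
`#(G/G³) = #G[3]` by comparing kernel and image of `x ↦ x³`). [folklore] -/
theorem exists_generators_mod_cubes (G : Type*) [CommGroup G] [Finite G] :
    ∃ (r : ℕ) (g : Fin r → G), 3 ^ r = Nat.card {x : G // x ^ 3 = 1} ∧
      ∀ x : G, ∃ (n : Fin r → ℕ) (y : G), x = (∏ i, g i ^ n i) * y ^ 3 := by
  classical
  haveI : Fact (Nat.Prime 3) := ⟨Nat.prime_three⟩
  set f : Additive G →+ Additive G := nsmulAddMonoidHom 3 with hf
  set N : AddSubgroup (Additive G) := f.range with hN
  have hN3 : ∀ a : Additive G, 3 • a ∈ N := fun a => ⟨a, rfl⟩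
  -- `#G[3] = #(G/G³)`
  have hcardQ : Nat.card {x : G // x ^ 3 = 1} = Nat.card (Additive G ⧸ N) := by
    have e2 : {x : G // x ^ 3 = 1} ≃ {a : Additive G // 3 • a = 0} :=
      Additive.ofMul.subtypeEquiv fun _ => Iff.rfl
    rw [Nat.card_congr e2]
    have hker : Nat.card {a : Additive G // 3 • a = 0} = Nat.card f.ker :=
      Nat.card_congr (Equiv.subtypeEquivRight fun a => by rw [AddMonoidHom.mem_ker]; rfl)
    rw [hker]
    have h1 := f.ker.card_mul_index
    have h2 := N.card_mul_index
    rw [AddSubgroup.index_eq_card,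
      Nat.card_congr (QuotientAddGroup.quotientKerEquivRange f).toEquiv] at h1
    rw [AddSubgroup.index_eq_card] at h2
    have hpos : 0 < Nat.card N := Nat.card_pos
    rw [← h2, mul_comm] at h1
    exact Nat.eq_of_mul_eq_mul_left hpos h1
  -- the `𝔽₃`-vector space `G/G³` and a basis
  haveI : Module (ZMod 3) (Additive G ⧸ N) := QuotientAddGroup.zmodModule hN3
  haveI : Module.Finite (ZMod 3) (Additive G ⧸ N) := Module.Finite.of_finite
  set r := Module.finrank (ZMod 3) (Additive G ⧸ N) with hr
  let bs := Module.finBasis (ZMod 3) (Additive G ⧸ N)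
  have hcard : Nat.card (Additive G ⧸ N) = 3 ^ r := by
    rw [Module.natCard_eq_pow_finrank (K := ZMod 3), Nat.card_zmod]
  refine ⟨r, fun i => Additive.toMul (Quotient.out (bs i)), by rw [hcardQ, hcard], fun x => ?_⟩
  set q : Additive G ⧸ N := QuotientAddGroup.mk (Additive.ofMul x) with hq
  refine ⟨fun i => (bs.repr q i).val, ?_⟩
  -- the lift `∑ nᵢ • out(bsᵢ)` of `q`
  set L : Additive G := ∑ i, (bs.repr q i).val • Quotient.out (bs i) with hL
  have hlift : (QuotientAddGroup.mk L : Additive G ⧸ N) = q := by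
    change QuotientAddGroup.mk' N L = q
    rw [hL, map_sum]
    conv_rhs => rw [← bs.sum_repr q]
    refine Finset.sum_congr rfl fun i _ => ?_
    rw [map_nsmul, QuotientAddGroup.mk'_apply, QuotientAddGroup.out_eq', ← Nat.cast_smul_eq_nsmul (ZMod 3),
      ZMod.natCast_zmod_val]
  have hmem : Additive.ofMul x - L ∈ N := by
    rw [← QuotientAddGroup.eq_iff_sub_mem, hlift]
  obtain ⟨a, ha⟩ := hmem
  refine ⟨Additive.toMul a, ?_⟩
  have hx : Additive.ofMul x = L + 3 • a := by
    have : f a = 3 • a := rfl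
    rw [← this, ha]; abel
  apply Additive.ofMul.injective
  rw [hx, hL]
  simp only [ofMul_mul, ofMul_prod, ofMul_pow, ofMul_toMul]
  rfl

/-! ### The count -/

/-- The cube roots of unity in `ℂ` form a finite set with at most `3` elements. [folklore] -/
theorem finite_setOf_pow_three_eq_one :
    {w : ℂ | w ^ 3 = 1}.Finite ∧ {w : ℂ | w ^ 3 = 1}.ncard ≤ 3 := by
  classical
  have hRe : {w : ℂ | w ^ 3 = 1} = ↑(Polynomial.nthRoots 3 (1 : ℂ)).toFinset := by
    ext w
    simp [Polynomial.mem_nthRoots (by norm_num : 0 < 3)]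
  rw [hRe]
  refine ⟨Finset.finite_toSet _, ?_⟩
  rw [Set.ncard_coe_finset]
  exact (Multiset.toFinset_card_le _).trans (Polynomial.card_nthRoots 3 1)

omit [NumberField K] in
/-- Prime avoidance for a product of powers of ideals. [folklore] -/
theorem prod_pow_mul_pow_not_le {r : ℕ} {𝔟 : Fin r → Ideal (𝓞 K)} {𝔠 : Ideal (𝓞 K)}
    {w : HeightOneSpectrum (𝓞 K)} (h𝔟 : ∀ i, ¬ 𝔟 i ≤ w.asIdeal) (h𝔠 : ¬ 𝔠 ≤ w.asIdeal) (n : Fin r → ℕ) :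
    ¬ (∏ i, 𝔟 i ^ n i) * 𝔠 ^ 3 ≤ w.asIdeal := by
  intro hle
  rcases (Ideal.IsPrime.mul_le w.isPrime).mp hle with h | h
  · obtain ⟨i, -, hi⟩ := (Ideal.IsPrime.prod_le w.isPrime).mp h
    by_cases hn : n i = 0
    · rw [hn, pow_zero, Ideal.one_eq_top, top_le_iff] at hi
      exact w.isPrime.ne_top hi
    · exact h𝔟 i ((Ideal.IsPrime.pow_le_iff (hP := w.isPrime) hn).mp hi)
  · exact h𝔠 ((Ideal.IsPrime.pow_le_iff (hP := w.isPrime) three_ne_zero).mp h)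

open scoped Classical in
/-- **The `3`-rank inequality, character form.**  Let `T` be a nonempty finite set of primes of the
number field `K` containing the primes above `3`, `Z ⊆ 𝓞_K` and `S ⊆ 𝓞_K` (finite) sets of integers
prime to `T` such that every integer prime to `T` is `≡ z ∏_{s ∈ S} s^{n_s}` modulo
`𝔪₀ = (∏_{v ∈ T, v ∤ 3} 𝔭_v) · 9` for some `z ∈ Z`.  Then the prime-value functions `ψ` of the cubic
Dirichlet characters modulo the nonzero moduli supported on `T` (`IsRayClassCharacter 𝔪 ψ`,
`ψ(𝔭)³ = 1` for `𝔭 ∉ T`, `ψ(𝔭) = 0` for `𝔭 ∈ T`) which kill `Z` (`ψ((z)) = 1`) form a finite set of at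
most `3^{#S} · #Cl(K)[3]` elements: `ψ ↦ ((ψ((s)))_{s ∈ S}, (ψ(𝔟ᵢ))ᵢ)` is injective, where the `𝔟ᵢ` are
integral ideals prime to `T` representing a basis of `Cl(K)/Cl(K)³` (`exists_generators_mod_cubes`,
`exists_ideal_mk0_eq`): `ψ(𝔭) = ψ(𝔡)²ψ((x))` with `𝔡𝔭 = (x)`, `𝔡 ∏ 𝔟ᵢ^{nᵢ} 𝔠³ = (x')`, and
`ψ((x)), ψ((x'))` are monomials in the `ψ((s))` (`exists_idealPow_span_eq_prod`).  This is the
"classical inequality bounding the `3`-rank of the ring class group modulo `q` of `ℚ(√D)` by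
`ω(q) + r₃(D) + O(1)`" (Belabas–Bhargava–Pomerance, proof of Lemma 3.3; Davenport–Heilbronn 1971 §6;
Hasse 1930). [cite: BelabasBhargavaPomerance2010, proof of Lemma 3.3] -/
theorem ncard_cubicRayClassFunctions_le (T : Finset (HeightOneSpectrum (𝓞 K))) (hT : T.Nonempty)
    (hT3 : ∀ v : HeightOneSpectrum (𝓞 K), (3 : 𝓞 K) ∈ v.asIdeal → v ∈ T)
    {Z : Set (𝓞 K)} (hZT : ∀ z ∈ Z, ∀ v ∈ T, z ∉ v.asIdeal)
    (S : Finset (𝓞 K)) (hST : ∀ s ∈ S, ∀ v ∈ T, s ∉ v.asIdeal)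
    (hgen : ∀ x : 𝓞 K, (∀ v ∈ T, x ∉ v.asIdeal) → ∃ z ∈ Z, ∃ n : 𝓞 K → ℕ,
      x - z * ∏ s ∈ S, s ^ n s ∈
        (∏ v ∈ T.filter (fun v => (3 : 𝓞 K) ∉ v.asIdeal), v.asIdeal) * Ideal.span {(9 : 𝓞 K)}) :
    {ψ : HeightOneSpectrum (𝓞 K) → ℂ |
        (∃ 𝔪 : Ideal (𝓞 K), 𝔪 ≠ ⊥ ∧ (∀ v : HeightOneSpectrum (𝓞 K), 𝔪 ≤ v.asIdeal → v ∈ T) ∧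
          IsRayClassCharacter 𝔪 ψ) ∧
        (∀ v, v ∉ T → ψ v ^ 3 = 1) ∧ (∀ v ∈ T, ψ v = 0) ∧
        ∀ z ∈ Z, idealPow K ψ (Ideal.span {z}) = 1}.Finite ∧
    {ψ : HeightOneSpectrum (𝓞 K) → ℂ |
        (∃ 𝔪 : Ideal (𝓞 K), 𝔪 ≠ ⊥ ∧ (∀ v : HeightOneSpectrum (𝓞 K), 𝔪 ≤ v.asIdeal → v ∈ T) ∧
          IsRayClassCharacter 𝔪 ψ) ∧
        (∀ v, v ∉ T → ψ v ^ 3 = 1) ∧ (∀ v ∈ T, ψ v = 0) ∧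
        ∀ z ∈ Z, idealPow K ψ (Ideal.span {z}) = 1}.ncard ≤
      3 ^ S.card * Nat.card {c : ClassGroup (𝓞 K) // c ^ 3 = 1} := by
  set Ψ := {ψ : HeightOneSpectrum (𝓞 K) → ℂ |
        (∃ 𝔪 : Ideal (𝓞 K), 𝔪 ≠ ⊥ ∧ (∀ v : HeightOneSpectrum (𝓞 K), 𝔪 ≤ v.asIdeal → v ∈ T) ∧
          IsRayClassCharacter 𝔪 ψ) ∧
        (∀ v, v ∉ T → ψ v ^ 3 = 1) ∧ (∀ v ∈ T, ψ v = 0) ∧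
        ∀ z ∈ Z, idealPow K ψ (Ideal.span {z}) = 1} with hΨ
  obtain ⟨v₀, hv₀⟩ := id hT
  have ne_zero_of : ∀ {x : 𝓞 K}, (∀ v ∈ T, x ∉ v.asIdeal) → x ≠ 0 := fun hx h0 =>
    hx v₀ hv₀ (h0 ▸ v₀.asIdeal.zero_mem)
  have span_ne_bot : ∀ {x : 𝓞 K}, (∀ v ∈ T, x ∉ v.asIdeal) → Ideal.span {x} ≠ ⊥ := fun hx => by
    rw [Ne, Ideal.span_singleton_eq_bot]; exact ne_zero_of hx
  have span_not_le : ∀ {x : 𝓞 K}, (∀ v ∈ T, x ∉ v.asIdeal) → ∀ v ∈ T, ¬ Ideal.span {x} ≤ v.asIdeal :=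
    fun hx v hv hle => hx v hv ((Ideal.span_singleton_le_iff_mem _).mp hle)
  -- generators of `Cl(K)` modulo cubes, represented by integral ideals prime to `T`
  obtain ⟨r, g, hr, hgCl⟩ := exists_generators_mod_cubes (ClassGroup (𝓞 K))
  choose 𝔟 h𝔟0 h𝔟T h𝔟g using fun i : Fin r => exists_ideal_mk0_eq T (g i)
  -- the map `ψ ↦ ((ψ((s)))_s, (ψ(𝔟ᵢ))ᵢ)` into functions with cube-root-of-unity values
  set Φ : (HeightOneSpectrum (𝓞 K) → ℂ) → (S ⊕ Fin r → ℂ) := fun ψ =>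
    Sum.elim (fun s => idealPow K ψ (Ideal.span {(s : 𝓞 K)})) (fun i => idealPow K ψ (𝔟 i)) with hΦ
  set R : Set ℂ := {w | w ^ 3 = 1} with hR
  set F : Set (S ⊕ Fin r → ℂ) := Set.univ.pi fun _ => R with hF
  have hFfin : F.Finite := Set.Finite.pi fun _ => finite_setOf_pow_three_eq_one.1
  have hFcard : F.ncard ≤ 3 ^ (S.card + r) := by
    haveI : Finite R := finite_setOf_pow_three_eq_one.1.to_subtype
    have e : F ≃ (S ⊕ Fin r → R) := Equiv.Set.univPi _
    rw [← Nat.card_coe_set_eq, Nat.card_congr e, Nat.card_fun, Nat.card_sum,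
      Nat.card_eq_fintype_card (α := ↥S), Fintype.card_coe, Nat.card_eq_fintype_card (α := Fin r),
      Fintype.card_fin, Nat.card_coe_set_eq]
    exact Nat.pow_le_pow_left finite_setOf_pow_three_eq_one.2 _
  have hmaps : ∀ ψ ∈ Ψ, Φ ψ ∈ F := by
    rintro ψ ⟨-, hcube, -, -⟩
    simp only [hF, Set.mem_univ_pi]
    rintro (s | i)
    · exact idealPow_pow_three_eq_one hcube (span_ne_bot (hST s s.2)) (span_not_le (hST s s.2))
    · exact idealPow_pow_three_eq_one hcube (h𝔟0 i) (h𝔟T i)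
  -- injectivity
  have hinj : Set.InjOn Φ Ψ := by
    rintro ψ₁ ⟨⟨𝔪₁, h𝔪₁0, h𝔪₁T, hray₁⟩, hcube₁, hzero₁, hZ₁⟩ ψ₂ ⟨⟨𝔪₂, h𝔪₂0, h𝔪₂T, hray₂⟩, hcube₂, hzero₂, hZ₂⟩ hΦeq
    obtain ⟨N₁, hN₁⟩ := exists_modulus_le h𝔪₁0 h𝔪₁T
    obtain ⟨N₂, hN₂⟩ := exists_modulus_le h𝔪₂0 h𝔪₂T
    set N := max N₁ N₂ with hN
    have hray₁' := hray₁.of_le ((modulus_le_modulus T (le_max_left N₁ N₂)).trans hN₁)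
    have hray₂' := hray₂.of_le ((modulus_le_modulus T (le_max_right N₁ N₂)).trans hN₂)
    have hS : ∀ s (hs : s ∈ S), idealPow K ψ₁ (Ideal.span {s}) = idealPow K ψ₂ (Ideal.span {s}) :=
      fun s hs => congrFun hΦeq (Sum.inl ⟨s, hs⟩)
    have hB : ∀ i, idealPow K ψ₁ (𝔟 i) = idealPow K ψ₂ (𝔟 i) := fun i => congrFun hΦeq (Sum.inr i)
    funext v
    by_cases hv : v ∈ T
    · rw [hzero₁ v hv, hzero₂ v hv]
    -- `[𝔭_v] = ∏ [𝔟ᵢ]^{nᵢ} [𝔠]³`, `𝔡 𝔭_v = (x)`, `𝔡 ∏ 𝔟ᵢ^{nᵢ} 𝔠³ = (x')`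
    have hIT : ∀ w ∈ T, ¬ v.asIdeal ≤ w.asIdeal := fun w hw hle =>
      hv ((HeightOneSpectrum.ext (v.isMaximal.eq_of_le w.isPrime.ne_top hle)) ▸ hw)
    obtain ⟨n, y, hy⟩ := hgCl (ClassGroup.mk0 ⟨v.asIdeal, mem_nonZeroDivisors_iff_ne_zero.mpr v.ne_bot⟩)
    obtain ⟨𝔠, h𝔠0, h𝔠T, h𝔠y⟩ := exists_ideal_mk0_eq T y
    obtain ⟨𝔡, h𝔡0, h𝔡T, h𝔡⟩ := exists_ideal_mk0_eq T
      (ClassGroup.mk0 ⟨v.asIdeal, mem_nonZeroDivisors_iff_ne_zero.mpr v.ne_bot⟩)⁻¹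
    set J := (∏ i, 𝔟 i ^ n i) * 𝔠 ^ 3 with hJdef
    have hJT : ∀ w ∈ T, ¬ J ≤ w.asIdeal := fun w hw =>
      prod_pow_mul_pow_not_le (fun i => h𝔟T i w hw) (h𝔠T w hw) n
    have hJ0 : J ≠ ⊥ := fun h => hJT v₀ hv₀ (h ▸ bot_le)
    have hJcl : ClassGroup.mk0 ⟨J, mem_nonZeroDivisors_iff_ne_zero.mpr hJ0⟩ =
        ClassGroup.mk0 ⟨v.asIdeal, mem_nonZeroDivisors_iff_ne_zero.mpr v.ne_bot⟩ := by
      rw [hy, ← h𝔠y]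
      have : (⟨J, mem_nonZeroDivisors_iff_ne_zero.mpr hJ0⟩ : (Ideal (𝓞 K))⁰) =
          (∏ i, ⟨𝔟 i, mem_nonZeroDivisors_iff_ne_zero.mpr (h𝔟0 i)⟩ ^ n i) *
            ⟨𝔠, mem_nonZeroDivisors_iff_ne_zero.mpr h𝔠0⟩ ^ 3 := by
        apply Subtype.ext
        simp only [hJdef, Submonoid.coe_mul, Submonoid.coe_finsetProd, SubmonoidClass.coe_pow]
      rw [this, map_mul, map_prod, map_pow]
      simp_rw [map_pow, h𝔟g]
    obtain ⟨x, hx0, hx⟩ := ClassGroup.mk0_eq_mk0_inv_iff.mp h𝔡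
    have h𝔡' : ClassGroup.mk0 ⟨𝔡, mem_nonZeroDivisors_iff_ne_zero.mpr h𝔡0⟩ =
        (ClassGroup.mk0 ⟨J, mem_nonZeroDivisors_iff_ne_zero.mpr hJ0⟩)⁻¹ := by rw [hJcl]; exact h𝔡
    obtain ⟨x', hx'0, hx'⟩ := ClassGroup.mk0_eq_mk0_inv_iff.mp h𝔡'
    change 𝔡 * v.asIdeal = Ideal.span {x} at hx
    change 𝔡 * J = Ideal.span {x'} at hx'
    have hxT : ∀ w ∈ T, x ∉ w.asIdeal := fun w hw hxw => by
      have hle : 𝔡 * v.asIdeal ≤ w.asIdeal := hx ▸ (Ideal.span_singleton_le_iff_mem _).mpr hxw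
      rcases (Ideal.IsPrime.mul_le w.isPrime).mp hle with h | h
      · exact h𝔡T w hw h
      · exact hIT w hw h
    have hx'T : ∀ w ∈ T, x' ∉ w.asIdeal := fun w hw hxw => by
      have hle : 𝔡 * J ≤ w.asIdeal := hx' ▸ (Ideal.span_singleton_le_iff_mem _).mpr hxw
      rcases (Ideal.IsPrime.mul_le w.isPrime).mp hle with h | h
      · exact h𝔡T w hw h
      · exact hJT w hw h
    obtain ⟨kx, hkx⟩ := exists_idealPow_span_eq_prod T hT hT3 hZT hST hgen N hxT
    obtain ⟨kx', hkx'⟩ := exists_idealPow_span_eq_prod T hT hT3 hZT hST hgen N hx'T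
    -- the common formula for `ψ(𝔭_v)`
    have formula : ∀ ψ : HeightOneSpectrum (𝓞 K) → ℂ,
        IsRayClassCharacter ((∏ v ∈ T.filter (fun v => (3 : 𝓞 K) ∉ v.asIdeal), v.asIdeal) ^ (N + 1) *
          Ideal.span {(3 : 𝓞 K)} ^ (N + 2)) ψ →
        (∀ v, v ∉ T → ψ v ^ 3 = 1) → (∀ z ∈ Z, idealPow K ψ (Ideal.span {z}) = 1) →
        ψ v = (∏ i, idealPow K ψ (𝔟 i) ^ n i) *
          (∏ s ∈ S, idealPow K ψ (Ideal.span {s}) ^ kx' s) ^ 2 *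
          ∏ s ∈ S, idealPow K ψ (Ideal.span {s}) ^ kx s := by
      intro ψ hray hcube hZ
      have e1 : idealPow K ψ 𝔡 * idealPow K ψ v.asIdeal = idealPow K ψ (Ideal.span {x}) := by
        rw [← idealPow_mul ψ h𝔡0 v.ne_bot, hx]
      have e2 : idealPow K ψ 𝔡 * idealPow K ψ J = idealPow K ψ (Ideal.span {x'}) := by
        rw [← idealPow_mul ψ h𝔡0 hJ0, hx']
      have hd3 : idealPow K ψ 𝔡 ^ 3 = 1 := idealPow_pow_three_eq_one hcube h𝔡0 h𝔡T
      have hx'3 : idealPow K ψ (Ideal.span {x'}) ^ 3 = 1 :=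
        idealPow_pow_three_eq_one hcube (span_ne_bot hx'T) (span_not_le hx'T)
      have hJval : idealPow K ψ J = ∏ i, idealPow K ψ (𝔟 i) ^ n i := by
        rw [hJdef, idealPow_mul ψ (prod_ne_zero_iff.mpr fun i _ => pow_ne_zero _ (h𝔟0 i)) (pow_ne_zero _ h𝔠0),
          idealPow_pow ψ h𝔠0, idealPow_pow_three_eq_one hcube h𝔠0 h𝔠T, mul_one,
          idealPow_prod ψ _ _ fun i _ => pow_ne_zero _ (h𝔟0 i)]
        exact prod_congr rfl fun i _ => idealPow_pow ψ (h𝔟0 i) (n i)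
      have eI : idealPow K ψ v.asIdeal = idealPow K ψ 𝔡 ^ 2 * idealPow K ψ (Ideal.span {x}) := by
        linear_combination (-idealPow K ψ v.asIdeal) * hd3 + idealPow K ψ 𝔡 ^ 2 * e1
      have eJ : idealPow K ψ J = idealPow K ψ 𝔡 ^ 2 * idealPow K ψ (Ideal.span {x'}) := by
        linear_combination (-idealPow K ψ J) * hd3 + idealPow K ψ 𝔡 ^ 2 * e2
      have hd2 : idealPow K ψ 𝔡 ^ 2 = idealPow K ψ J * idealPow K ψ (Ideal.span {x'}) ^ 2 := by
        linear_combination (-(idealPow K ψ 𝔡 ^ 2)) * hx'3 - idealPow K ψ (Ideal.span {x'}) ^ 2 * eJ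
      rw [← idealPow_asIdeal ψ v, eI, hd2, hJval, hkx ψ hray hcube hZ, hkx' ψ hray hcube hZ]
    rw [formula ψ₁ hray₁' hcube₁ hZ₁, formula ψ₂ hray₂' hcube₂ hZ₂]
    refine congrArg₂ (· * ·) (congrArg₂ (· * ·) (prod_congr rfl fun i _ => by rw [hB i])
      (congrArg (· ^ 2) (prod_congr rfl fun s hs => by rw [hS s hs]))) (prod_congr rfl fun s hs => by rw [hS s hs])
  refine ⟨Set.Finite.of_finite_image (hFfin.subset (Set.image_subset_iff.mpr hmaps)) hinj, ?_⟩
  calc Ψ.ncard ≤ F.ncard := Set.ncard_le_ncard_of_injOn Φ hmaps hinj hFfin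
    _ ≤ 3 ^ (S.card + r) := hFcard
    _ = 3 ^ S.card * Nat.card {c : ClassGroup (𝓞 K) // c ^ 3 = 1} := by rw [pow_add, hr]

end Literature.NumberTheory.LFunctions

end
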